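import Literature.AlgebraicGeometry.Resolution.RegularCentreComponents
import Literature.AlgebraicGeometry.Resolution.TransformCompDisjoint
import Literature.AlgebraicGeometry.Resolution.BlowupsExistence
import Literature.AlgebraicGeometry.Resolution.BlowupsLocal
import Literature.AlgebraicGeometry.Resolution.BlowupsProperProofs
import HarnessLib

/-!
# Splitting a blow-up along a disconnected centre: a blow-up along `𝓘(Z₁)·𝓘(Z₂)`, `Z₁ ∩ Z₂ = ∅`,
# factors as the blow-up along `𝓘(Z₁)` followed by the blow-up along `𝓘(Z₂)𝒪`

Topic: `Literature/AlgebraicGeometry/Resolution`. Stacks 080A (tree `IsBlowup.comp`, `BlowupsProduct.lean`: the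
composite of a blow-up along `P` and a blow-up along the pulled-back `R` is a blow-up along `P · R`) READ BACKWARDS,
with the existence (`exists_isBlowup`, Görtz–Wedhorn I Prop. 13.92) and uniqueness (`IsBlowup.unique`, GW after
Def. 13.90) of blow-ups: **every blow-up `τ : X′ → X` along a product `I₁ · I₂` FACTORS as `τ = τ₂ ≫ τ₁` with `τ₁` a
blow-up of `X` along `I₁` and `τ₂` a blow-up of its source along `I₂ 𝒪 = τ₁^* I₂`** — for ANY blow-up `τ₁` along
`I₁`, the factor `τ₂` being unique (`IsBlowup.exists_fac_of_mul`, `IsBlowup.fac_unique_of_mul`,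
`IsBlowup.exists_comp_eq_of_mul`). No disjointness is needed for the factorisation itself.

For DISJOINT centres the second centre does not notice the first blow-up (`BlowupOffCentre.lean`: a blow-up is an
isomorphism off its centre, GW Prop. 13.91 (3) = Stacks 02OS), which gives the form used to re-sequence a blow-up
along a regular but disconnected centre into blow-ups along its connected (or irreducible) components
(Bierstone–Grigoriev–Milman–Włodarczyk 2011, §4 Step 2b; Cossart–Jannsen–Saito centres may be disconnected):

* `vanishingIdeal_sup_eq_mul_of_disjoint` — `𝓘(Z₁ ⊔ Z₂) = 𝓘(Z₁) · 𝓘(Z₂)` for disjoint closed `Z₁, Z₂`;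
* `isRegular_subscheme_mul_of_disjoint_support`, `isRegular_subscheme_prod_of_pairwise_disjoint` — a product of
  ideal sheaves with pairwise disjoint supports and regular subschemes has a regular subscheme;
* `IsBlowup.exists_comp_eq_of_disjoint` — **the split of a blow-up along `𝓘(Z₁)·𝓘(Z₂)`** (`X` locally Noetherian):
  `τ = τ₂ ≫ τ₁`, `τ₁` a blow-up along `𝓘(Z₁)`, `τ₂` a blow-up along the REDUCED ideal `𝓘(τ₁⁻¹Z₂) = τ₁^*𝓘(Z₂)`
  (tree `IsBlowup.comap_vanishingIdeal_of_disjoint`), `τ₁` an isomorphism over `X ∖ Z₁ ⊇ Z₂`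
  (`IsBlowup.isIso_morphismRestrict_compl_of_vanishingIdeal`), and `V(𝓘(τ₁⁻¹Z₂))` regular (resp. `τ₁⁻¹Z₂`
  irreducible) when `V(𝓘(Z₂))` is (resp. `Z₂` is) (tree `IsBlowup.isRegular_subscheme_vanishingIdeal_preimage`,
  `IsBlowup.isIrreducible_preimage_of_disjoint`);
* `IsBlowup.exists_comp_eq_of_isPiecePartition_cons` — **induction-ready peeling of one piece of a regular centre**:
  for `V(C)` regular with a partition `Z :: Zs` into pairwise disjoint closed pieces (`IsPiecePartition`,
  `BoundarySplitting.lean`; e.g. its connected = irreducible components, `RegularCentreComponents.lean`), a blow-up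
  `τ` along `C` factors as `τ = τ₂ ≫ τ₁` with `τ₁` a blow-up along `𝓘(Z)` (regular centre, integral if `Z` is
  irreducible) and `τ₂` a blow-up of the locally Noetherian `X₁` along `C₁ = Π_{W ∈ Zs} 𝓘(τ₁⁻¹W) = τ₁^*(Π_{W∈Zs} 𝓘(W))`,
  again the ideal of a REGULAR centre with the piece partition `τ₁⁻¹Zs` (one piece fewer) — so any inductive
  carrier of blow-up sequences can recurse on the number of pieces.

Everything is proved over the tree's carriers (`IsBlowup`, `IsPiecePartition`, `pieceIdeals`); no definitions are
introduced. Written for the HIRONAKA-L lane (cell res-hironaka, W5.2 «TargetsF5», piece T5-E/P2 «SPLITTING» of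
res-D-pv-054's plan) by res-type-002.

## References
* The Stacks Project, Tag 080A (blowing up in a product of ideals), Tag 02OS (a blowing up is an isomorphism away
  from the centre), Tag 0806 (existence and universal property). [StacksProject]
* U. Görtz, T. Wedhorn, *Algebraic Geometry I* (2nd ed. 2020), Def. 13.90, Prop. 13.91, Prop. 13.92.
  [GortzWedhorn2020]
* E. Bierstone, D. Grigoriev, P. Milman, J. Włodarczyk, *Effective Hironaka resolution and its complexity*, Asian J.
  Math. 15 (2011), arXiv:1206.3090, §4 Step 2b. [BierstoneGrigorievMilmanWlodarczyk2011]
-/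

noncomputable section

open CategoryTheory AlgebraicGeometry TopologicalSpace IsLocalRing

namespace Literature.AlgebraicGeometry.Resolution

universe u

open Scheme.IdealSheafData

variable {X X' : Scheme.{u}} {τ : X' ⟶ X}

/-! ## Stacks 080A read backwards: factoring a blow-up along a product -/

section Product

variable {I₁ I₂ : X.IdealSheafData}

/-- **A blow-up along `I₁ · I₂` factors through ANY blow-up along `I₁`**: if `τ` is a blow-up of `X` along `I₁·I₂`
and `τ₁ : X₁ → X` is a blow-up along `I₁`, there is `τ₂ : X′ → X₁`, a blow-up of `X₁` along `τ₁^*I₂ = I₂𝒪_{X₁}`,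
with `τ₂ ≫ τ₁ = τ` (Stacks 080A gives a blow-up `X₂ → X₁ → X` along `I₁·I₂`; uniqueness of blow-ups identifies
it with `τ`). [cite: StacksProject, Tag 080A] -/
theorem IsBlowup.exists_fac_of_mul (hτ : IsBlowup τ (I₁ * I₂)) {X₁ : Scheme.{u}} {τ₁ : X₁ ⟶ X}
    (hτ₁ : IsBlowup τ₁ I₁) : ∃ τ₂ : X' ⟶ X₁, IsBlowup τ₂ (I₂.comap τ₁) ∧ τ₂ ≫ τ₁ = τ := by
  obtain ⟨X₂, ρ, hρ⟩ := exists_isBlowup X₁ (I₂.comap τ₁)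
  obtain ⟨e, he, -⟩ := hτ.unique (hτ₁.comp hρ)
  exact ⟨e.hom ≫ ρ, hρ.iso_comp e, by rw [Category.assoc, he]⟩

/-- The pull-back of the first factor `I₁` along a blow-up along `I₁ · I₂` is an effective Cartier divisor
(Stacks 07ZV: a factor of an effective Cartier product is effective Cartier). [cite: StacksProject, Tag 07ZV] -/
theorem IsBlowup.isEffectiveCartier_comap_left_of_mul (hτ : IsBlowup τ (I₁ * I₂)) :
    IsEffectiveCartier (I₁.comap τ) := by
  have h := hτ.isEffectiveCartier
  rw [comap_mul] at h
  exact h.of_mul_left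

/-- The pull-back of the second factor `I₂` along a blow-up along `I₁ · I₂` is an effective Cartier divisor.
[cite: StacksProject, Tag 07ZV] -/
theorem IsBlowup.isEffectiveCartier_comap_right_of_mul (hτ : IsBlowup τ (I₁ * I₂)) :
    IsEffectiveCartier (I₂.comap τ) := by
  have h := hτ.isEffectiveCartier
  rw [comap_mul] at h
  exact h.of_mul_right

/-- **The factor is unique**: two morphisms `X′ → X₁` over `X` agree, `τ₁` being a blow-up along `I₁` and `τ`
pulling `I₁` back to an effective Cartier divisor. [cite: StacksProject, Tag 080A] -/
theorem IsBlowup.fac_unique_of_mul (hτ : IsBlowup τ (I₁ * I₂)) {X₁ : Scheme.{u}} {τ₁ : X₁ ⟶ X}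
    (hτ₁ : IsBlowup τ₁ I₁) {g g' : X' ⟶ X₁} (hg : g ≫ τ₁ = τ) (hg' : g' ≫ τ₁ = τ) : g = g' := by
  apply hτ₁.hom_ext
  · rw [hg]
    exact hτ.isEffectiveCartier_comap_left_of_mul
  · rw [hg, hg']

/-- **Splitting a blow-up along a product** (Stacks 080A read backwards): a blow-up `τ` of `X` along `I₁ · I₂`
factors as `τ = τ₂ ≫ τ₁`, `τ₁ : X₁ → X` a blow-up along `I₁` and `τ₂ : X′ → X₁` a blow-up along `I₂𝒪_{X₁}`.
[cite: StacksProject, Tag 080A] -/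
theorem IsBlowup.exists_comp_eq_of_mul (hτ : IsBlowup τ (I₁ * I₂)) :
    ∃ (X₁ : Scheme.{u}) (τ₁ : X₁ ⟶ X) (τ₂ : X' ⟶ X₁),
      IsBlowup τ₁ I₁ ∧ IsBlowup τ₂ (I₂.comap τ₁) ∧ τ₂ ≫ τ₁ = τ := by
  obtain ⟨X₁, τ₁, hτ₁⟩ := exists_isBlowup X I₁
  obtain ⟨τ₂, hτ₂, h⟩ := hτ.exists_fac_of_mul hτ₁
  exact ⟨X₁, τ₁, τ₂, hτ₁, hτ₂, h⟩

/-- The same with the factors blown up in the other order (`I₁ · I₂ = I₂ · I₁`). [cite: StacksProject, Tag 080A] -/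
theorem IsBlowup.exists_comp_eq_of_mul' (hτ : IsBlowup τ (I₁ * I₂)) :
    ∃ (X₁ : Scheme.{u}) (τ₁ : X₁ ⟶ X) (τ₂ : X' ⟶ X₁),
      IsBlowup τ₁ I₂ ∧ IsBlowup τ₂ (I₁.comap τ₁) ∧ τ₂ ≫ τ₁ = τ := by
  rw [mul_comm] at hτ
  exact hτ.exists_comp_eq_of_mul

/-- The intermediate scheme of a splitting is locally Noetherian if `X` is (blow-ups of locally Noetherian schemes
are projective — Stacks 02NS / Görtz–Wedhorn I Prop. 13.96 (1) — hence locally of finite type; tree `IsBlowup.isProper`).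
[cite: StacksProject, Tag 02NS] -/
theorem IsBlowup.isLocallyNoetherian [IsLocallyNoetherian X] {I : X.IdealSheafData} (hτ : IsBlowup τ I) :
    IsLocallyNoetherian X' := by
  haveI : IsProper τ := hτ.isProper
  exact LocallyOfFiniteType.isLocallyNoetherian τ

end Product

/-! ## Products of ideal sheaves with disjoint supports -/

section DisjointSupport

/-- `𝓘(Z₁ ⊔ Z₂) = 𝓘(Z₁) · 𝓘(Z₂)` for DISJOINT closed subsets (the factors are comaximal, so the product is the
intersection `𝓘(Z₁) ⊓ 𝓘(Z₂) = 𝓘(Z₁ ∪ Z₂)`). [cite: BierstoneGrigorievMilmanWlodarczyk2011, §4 Step 2 (p. 12)] -/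
theorem vanishingIdeal_sup_eq_mul_of_disjoint {Z₁ Z₂ : Closeds X} (hZ : Disjoint (Z₁ : Set X) (Z₂ : Set X)) :
    vanishingIdeal (Z₁ ⊔ Z₂) = vanishingIdeal Z₁ * vanishingIdeal Z₂ := by
  rw [Scheme.IdealSheafData.vanishingIdeal_sup, IdealSheafData.mul_eq_inf_of_sup_eq_top]
  apply IdealSheafData.sup_eq_top_of_disjoint_support
  rwa [coe_support_vanishingIdeal, coe_support_vanishingIdeal]

/-- At a point off the support of `J`, the product `I · J` has the stalk of `I`. [folklore] -/
private theorem stalkIdeal_mul_of_not_mem_right {I J : X.IdealSheafData} {x : X} (hx : x ∉ J.support) :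
    stalkIdeal (I * J) x = stalkIdeal I x := by
  rw [stalkIdeal_mul, stalkIdeal_eq_top_of_not_mem_support hx, Ideal.mul_top]

/-- At a point off the support of `I`, the product `I · J` has the stalk of `J`. [folklore] -/
private theorem stalkIdeal_mul_of_not_mem_left {I J : X.IdealSheafData} {x : X} (hx : x ∉ I.support) :
    stalkIdeal (I * J) x = stalkIdeal J x := by
  rw [stalkIdeal_mul, stalkIdeal_eq_top_of_not_mem_support hx, Ideal.top_mul]

variable [IsLocallyNoetherian X]

/-- **A product of two ideal sheaves with disjoint supports and regular subschemes has a regular subscheme**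
(`V(I·J) = V(I) ⊔ V(J)`; regularity is a condition on the local rings, Stacks 02IS, and the quotient stalk at a point
of `V(I)` off `V(J)` is that of `V(I)`). [cite: StacksProject, Tag 02IS] -/
theorem isRegular_subscheme_mul_of_disjoint_support {I J : X.IdealSheafData}
    (hI : Scheme.IsRegular I.subscheme) (hJ : Scheme.IsRegular J.subscheme)
    (h : Disjoint (I.support : Set X) J.support) : Scheme.IsRegular (I * J).subscheme := by
  rw [Scheme.isRegular_subscheme_iff] at hI hJ ⊢
  intro x hx
  have hx' : x ∈ ((I.support ⊔ J.support : Closeds X) : Set X) := by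
    rwa [Scheme.IdealSheafData.support_mul] at hx
  rw [Closeds.coe_sup] at hx'
  rcases hx' with hx | hx
  · have hxJ : x ∉ J.support := fun h' => h.le_bot ⟨hx, h'⟩
    rw [stalkIdeal_mul_of_not_mem_right hxJ]
    exact hI x hx
  · have hxI : x ∉ I.support := fun h' => h.le_bot ⟨h', hx⟩
    rw [stalkIdeal_mul_of_not_mem_left hxI]
    exact hJ x hx

/-- The empty closed subscheme `V(⊤)` is regular (no local rings to check, Stacks 02IS). [cite: StacksProject, Tag 02IS] -/
theorem isRegular_subscheme_top : Scheme.IsRegular (⊤ : X.IdealSheafData).subscheme := by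
  rw [Scheme.isRegular_subscheme_iff]
  intro x hx
  rw [Scheme.IdealSheafData.support_top] at hx
  exact absurd hx (Set.notMem_empty x)

/-- **A product of ideal sheaves with pairwise disjoint supports and regular subschemes has a regular subscheme**
(regularity is a condition on the local rings, Stacks 02IS; `V(Π I) = ⨆ V(I)` with the summands open and closed).
[cite: StacksProject, Tag 02IS] -/
theorem isRegular_subscheme_prod_of_pairwise_disjoint (L : List X.IdealSheafData)
    (hreg : ∀ I ∈ L, Scheme.IsRegular I.subscheme)
    (h : L.Pairwise fun (I J : X.IdealSheafData) => Disjoint (I.support : Set X) J.support) :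
    Scheme.IsRegular L.prod.subscheme := by
  induction L with
  | nil =>
    rw [List.prod_nil, Scheme.IdealSheafData.one_eq_top]
    exact isRegular_subscheme_top
  | cons I L ih =>
    rw [List.pairwise_cons] at h
    rw [List.prod_cons]
    refine isRegular_subscheme_mul_of_disjoint_support (hreg I (List.mem_cons_self ..))
      (ih (fun J hJ => hreg J (List.mem_cons_of_mem _ hJ)) h.2) ?_
    rw [IdealSheafData.coe_support_prod, Set.disjoint_iUnion₂_right]
    exact fun J hJ => h.1 J hJ

end DisjointSupport

/-! ## Splitting a blow-up along two disjoint reduced centres -/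

section Disjoint

variable {Z₁ Z₂ : Closeds X}

/-- A blow-up along `𝓘(Z₁)` is an isomorphism over the open complement `X ∖ Z₁` (GW Prop. 13.91 (3), tree
`IsBlowup.isIso_morphismRestrict`). [cite: GortzWedhorn2020, Prop. 13.91 (3)] -/
theorem IsBlowup.isIso_morphismRestrict_compl_of_vanishingIdeal {X₁ : Scheme.{u}} {τ₁ : X₁ ⟶ X}
    (hτ₁ : IsBlowup τ₁ (vanishingIdeal Z₁)) : IsIso (τ₁ ∣_ Z₁.compl) := by
  apply hτ₁.isIso_morphismRestrict
  rw [coe_support_vanishingIdeal]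
  exact disjoint_compl_left

variable (hZ : Disjoint (Z₁ : Set X) (Z₂ : Set X))
include hZ

/-- `Z₂` is disjoint from the centre `V(𝓘(Z₁)) = Z₁`. [folklore] -/
private theorem disjoint_support_vanishingIdeal_of_disjoint :
    Disjoint (Z₂ : Set X) ((vanishingIdeal Z₁).support : Set X) := by
  rwa [coe_support_vanishingIdeal, disjoint_comm]

variable [IsLocallyNoetherian X]

/-- **Splitting a blow-up along `𝓘(Z₁) · 𝓘(Z₂)` for disjoint closed `Z₁, Z₂`** (`X` locally Noetherian), through
ANY blow-up `τ₁ : X₁ → X` along `𝓘(Z₁)`: there is a blow-up `τ₂ : X′ → X₁` along the REDUCED ideal sheaf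
`𝓘(τ₁⁻¹Z₂)` (`= τ₁^*𝓘(Z₂)`, `τ₁` being an isomorphism near `Z₂`) with `τ₂ ≫ τ₁ = τ`.
[cite: StacksProject, Tag 080A] -/
theorem IsBlowup.exists_fac_of_disjoint (hτ : IsBlowup τ (vanishingIdeal Z₁ * vanishingIdeal Z₂))
    {X₁ : Scheme.{u}} {τ₁ : X₁ ⟶ X} (hτ₁ : IsBlowup τ₁ (vanishingIdeal Z₁)) :
    ∃ τ₂ : X' ⟶ X₁, IsBlowup τ₂ (vanishingIdeal (Z₂.preimage τ₁.continuous)) ∧ τ₂ ≫ τ₁ = τ := by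
  rw [← hτ₁.comap_vanishingIdeal_of_disjoint Z₂ (disjoint_support_vanishingIdeal_of_disjoint hZ)]
  exact hτ.exists_fac_of_mul hτ₁

/-- **Splitting a blow-up along `𝓘(Z₁) · 𝓘(Z₂)` for disjoint closed `Z₁, Z₂`** (`X` locally Noetherian):
`τ = τ₂ ≫ τ₁` with `τ₁ : X₁ → X` a blow-up along `𝓘(Z₁)` — an isomorphism over `X ∖ Z₁ ⊇ Z₂` — and
`τ₂ : X′ → X₁` a blow-up along the reduced ideal sheaf `𝓘(τ₁⁻¹Z₂) = τ₁^*𝓘(Z₂)` of the preimage of the second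
centre; `X₁` is locally Noetherian. [cite: StacksProject, Tag 080A] -/
theorem IsBlowup.exists_comp_eq_of_disjoint (hτ : IsBlowup τ (vanishingIdeal Z₁ * vanishingIdeal Z₂)) :
    ∃ (X₁ : Scheme.{u}) (τ₁ : X₁ ⟶ X) (τ₂ : X' ⟶ X₁), τ₂ ≫ τ₁ = τ ∧
      IsBlowup τ₁ (vanishingIdeal Z₁) ∧ IsIso (τ₁ ∣_ Z₁.compl) ∧ IsLocallyNoetherian X₁ ∧
      (vanishingIdeal Z₂).comap τ₁ = vanishingIdeal (Z₂.preimage τ₁.continuous) ∧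
      IsBlowup τ₂ (vanishingIdeal (Z₂.preimage τ₁.continuous)) := by
  obtain ⟨X₁, τ₁, hτ₁⟩ := exists_isBlowup X (vanishingIdeal Z₁)
  obtain ⟨τ₂, hτ₂, h⟩ := hτ.exists_fac_of_disjoint hZ hτ₁
  exact ⟨X₁, τ₁, τ₂, h, hτ₁, hτ₁.isIso_morphismRestrict_compl_of_vanishingIdeal, hτ₁.isLocallyNoetherian,
    hτ₁.comap_vanishingIdeal_of_disjoint Z₂ (disjoint_support_vanishingIdeal_of_disjoint hZ), hτ₂⟩

/-- Under a blow-up along `𝓘(Z₁)`, the reduced preimage `V(𝓘(τ₁⁻¹Z₂))` of a disjoint `Z₂` with `V(𝓘(Z₂))` regular is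
regular (tree `IsBlowup.isRegular_subscheme_vanishingIdeal_preimage`, restated with the disjointness of the closed
sets as hypothesis). [cite: BierstoneGrigorievMilmanWlodarczyk2011, Thm. 8.0.5 with Def. 3.1.3] -/
theorem IsBlowup.isRegular_subscheme_vanishingIdeal_preimage_of_disjoint {X₁ : Scheme.{u}} {τ₁ : X₁ ⟶ X}
    (hτ₁ : IsBlowup τ₁ (vanishingIdeal Z₁)) (hreg : Scheme.IsRegular (vanishingIdeal Z₂).subscheme) :
    Scheme.IsRegular (vanishingIdeal (Z₂.preimage τ₁.continuous)).subscheme :=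
  hτ₁.isRegular_subscheme_vanishingIdeal_preimage Z₂ (disjoint_support_vanishingIdeal_of_disjoint hZ) hreg

omit [IsLocallyNoetherian X] in
/-- Under a blow-up along `𝓘(Z₁)`, the preimage of a disjoint irreducible `Z₂` is irreducible (tree
`IsBlowup.isIrreducible_preimage_of_disjoint`). [cite: GortzWedhorn2020, Prop. 13.91 (3)] -/
theorem IsBlowup.isIrreducible_preimage_of_disjoint' {X₁ : Scheme.{u}} {τ₁ : X₁ ⟶ X}
    (hτ₁ : IsBlowup τ₁ (vanishingIdeal Z₁)) (hirr : IsIrreducible (Z₂ : Set X)) :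
    IsIrreducible (Z₂.preimage τ₁.continuous : Set X₁) :=
  hτ₁.isIrreducible_preimage_of_disjoint Z₂ (disjoint_support_vanishingIdeal_of_disjoint hZ) hirr

end Disjoint

/-! ## Peeling one piece off a regular centre -/

section Pieces

variable {C : X.IdealSheafData}

/-- The pieces after the head of a piece partition `Z :: Zs` are disjoint from the head (pairwise disjointness of the
pieces, BGMW §4 Step 2). [cite: BierstoneGrigorievMilmanWlodarczyk2011, §4 Step 2 (p. 12)] -/
theorem IsPiecePartition.disjoint_of_mem_tail {Z : Closeds X} {Zs : List (Closeds X)}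
    (hP : IsPiecePartition C (Z :: Zs)) {W : Closeds X} (hW : W ∈ Zs) : Disjoint (Z : Set X) (W : Set X) :=
  (List.pairwise_cons.mp hP.1).1 W hW

/-- The tail of a piece partition has pairwise disjoint pieces (BGMW §4 Step 2).
[cite: BierstoneGrigorievMilmanWlodarczyk2011, §4 Step 2 (p. 12)] -/
theorem IsPiecePartition.pairwise_tail {Z : Closeds X} {Zs : List (Closeds X)}
    (hP : IsPiecePartition C (Z :: Zs)) :
    Zs.Pairwise fun (W W' : Closeds X) => Disjoint (W : Set X) (W' : Set X) :=
  (List.pairwise_cons.mp hP.1).2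

/-- The product of the piece ideals of pairwise disjoint closed pieces is the ideal of a centre partitioned by
those pieces (`V(Π_W 𝓘(W)) = ⋃ W`, BGMW §4 Step 2: a centre split into its disjoint pieces).
[cite: BierstoneGrigorievMilmanWlodarczyk2011, §4 Step 2 (p. 12)] -/
theorem isPiecePartition_prod_pieceIdeals {Y : Scheme.{u}} {Ws : List (Closeds Y)}
    (h : Ws.Pairwise fun (W W' : Closeds Y) => Disjoint (W : Set Y) (W' : Set Y)) :
    IsPiecePartition (pieceIdeals Ws).prod Ws := by
  refine ⟨h, ?_⟩
  rw [IdealSheafData.coe_support_prod]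
  ext y
  simp only [pieceIdeals, List.mem_map, Set.mem_iUnion, exists_prop]
  constructor
  · rintro ⟨W, hW, hy⟩
    exact ⟨vanishingIdeal W, ⟨W, hW, rfl⟩, by rwa [coe_support_vanishingIdeal]⟩
  · rintro ⟨_, ⟨W, hW, rfl⟩, hy⟩
    exact ⟨W, hW, by rwa [coe_support_vanishingIdeal] at hy⟩

variable [IsLocallyNoetherian X]

/-- **Pulling the remaining pieces back along the blow-up of the first piece**: for `τ₁` a blow-up along `𝓘(Z)`
and closed pieces `Zs` all disjoint from `Z`, `τ₁^*(Π_{W ∈ Zs} 𝓘(W)) = Π_{W ∈ Zs} 𝓘(τ₁⁻¹W)` (reduced ideals; tree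
`IsBlowup.comap_vanishingIdeal_of_disjoint` factorwise, `comap` being multiplicative). [cite: StacksProject, Tag 02OS] -/
theorem IsBlowup.comap_prod_pieceIdeals_of_disjoint {X₁ : Scheme.{u}} {τ₁ : X₁ ⟶ X} {Z : Closeds X}
    (hτ₁ : IsBlowup τ₁ (vanishingIdeal Z)) {Zs : List (Closeds X)}
    (hZs : ∀ W ∈ Zs, Disjoint (Z : Set X) (W : Set X)) :
    ((pieceIdeals Zs).prod).comap τ₁ = (pieceIdeals (Zs.map fun W => W.preimage τ₁.continuous)).prod := by
  induction Zs with
  | nil => simp [pieceIdeals, Scheme.IdealSheafData.one_eq_top]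
  | cons W Zs ih =>
    simp only [pieceIdeals, List.map_cons, List.prod_cons] at ih ⊢
    rw [comap_mul, ih fun W' hW' => hZs W' (List.mem_cons_of_mem _ hW'),
      hτ₁.comap_vanishingIdeal_of_disjoint W
        (disjoint_support_vanishingIdeal_of_disjoint (hZs W (List.mem_cons_self ..)))]

/-- **Peeling one piece off a regular centre** (induction-ready form of the splitting): let `V(C)` be regular
(`X` locally Noetherian) with a partition `Z :: Zs` into pairwise disjoint closed pieces, and `τ : X′ → X` a
blow-up along `C`. Then `τ = τ₂ ≫ τ₁` where `τ₁ : X₁ → X` is a blow-up along `𝓘(Z)` — `V(𝓘(Z))` regular, `τ₁` an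
isomorphism over `X ∖ Z`, `X₁` locally Noetherian — and `τ₂ : X′ → X₁` is a blow-up along
`C₁ = τ₁^*(Π_{W∈Zs} 𝓘(W)) = Π_{W∈Zs} 𝓘(τ₁⁻¹W)`, the ideal of a REGULAR centre of `X₁` with the piece partition
`τ₁⁻¹Zs` (one piece fewer). With `C = 𝓘(Z) · Π_{W∈Zs} 𝓘(W)` (tree `prod_pieceIdeals_eq_of_isRegular`) and Stacks 080A.
[cite: BierstoneGrigorievMilmanWlodarczyk2011, §4 Step 2b (p. 13)] -/
theorem IsBlowup.exists_comp_eq_of_isPiecePartition_cons (hC : Scheme.IsRegular C.subscheme) {Z : Closeds X}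
    {Zs : List (Closeds X)} (hP : IsPiecePartition C (Z :: Zs)) (hτ : IsBlowup τ C) :
    ∃ (X₁ : Scheme.{u}) (τ₁ : X₁ ⟶ X) (τ₂ : X' ⟶ X₁), τ₂ ≫ τ₁ = τ ∧
      IsBlowup τ₁ (vanishingIdeal Z) ∧ Scheme.IsRegular (vanishingIdeal Z).subscheme ∧
      IsIso (τ₁ ∣_ Z.compl) ∧ IsLocallyNoetherian X₁ ∧
      ((pieceIdeals Zs).prod).comap τ₁ = (pieceIdeals (Zs.map fun W => W.preimage τ₁.continuous)).prod ∧
      IsBlowup τ₂ (pieceIdeals (Zs.map fun W => W.preimage τ₁.continuous)).prod ∧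
      Scheme.IsRegular ((pieceIdeals (Zs.map fun W => W.preimage τ₁.continuous)).prod).subscheme ∧
      IsPiecePartition ((pieceIdeals (Zs.map fun W => W.preimage τ₁.continuous)).prod)
        (Zs.map fun W => W.preimage τ₁.continuous) := by
  -- `C = 𝓘(Z) · Π 𝓘(W)`
  have hCprod : C = vanishingIdeal Z * (pieceIdeals Zs).prod := by
    rw [← prod_pieceIdeals_eq_of_isRegular hC hP]
    simp [pieceIdeals]
  rw [hCprod] at hτ
  obtain ⟨X₁, τ₁, hτ₁⟩ := exists_isBlowup X (vanishingIdeal Z)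
  obtain ⟨τ₂, hτ₂, h⟩ := hτ.exists_fac_of_mul hτ₁
  have hdisj : ∀ W ∈ Zs, Disjoint (Z : Set X) (W : Set X) := fun W hW => hP.disjoint_of_mem_tail hW
  have hcomap := hτ₁.comap_prod_pieceIdeals_of_disjoint hdisj
  haveI : IsLocallyNoetherian X₁ := hτ₁.isLocallyNoetherian
  -- the pulled-back pieces are pairwise disjoint
  have hpw : (Zs.map fun W => W.preimage τ₁.continuous).Pairwise
      fun (W W' : Closeds X₁) => Disjoint (W : Set X₁) (W' : Set X₁) := by
    rw [List.pairwise_map]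
    exact hP.pairwise_tail.imp fun {W W'} hd => by
      rw [Closeds.coe_preimage, Closeds.coe_preimage]
      exact hd.preimage _
  refine ⟨X₁, τ₁, τ₂, h, hτ₁, isRegular_subscheme_vanishingIdeal_piece hC hP (List.mem_cons_self ..),
    hτ₁.isIso_morphismRestrict_compl_of_vanishingIdeal, inferInstance, hcomap, hcomap ▸ hτ₂, ?_,
    isPiecePartition_prod_pieceIdeals hpw⟩
  -- regularity of the remaining centre: factorwise
  refine isRegular_subscheme_prod_of_pairwise_disjoint _ (fun I hI => ?_) ?_
  · obtain ⟨W₁, hW₁, rfl⟩ := List.mem_map.mp hI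
    obtain ⟨W, hW, rfl⟩ := List.mem_map.mp hW₁
    exact hτ₁.isRegular_subscheme_vanishingIdeal_preimage_of_disjoint (hdisj W hW)
      (isRegular_subscheme_vanishingIdeal_piece hC hP (List.mem_cons_of_mem _ hW))
  · unfold pieceIdeals
    rw [List.pairwise_map]
    exact hpw.imp fun {W W'} hd => by rwa [coe_support_vanishingIdeal, coe_support_vanishingIdeal]

omit [IsLocallyNoetherian X] in
/-- The pieces of the remaining centre are irreducible if the original pieces are. [cite: GortzWedhorn2020, Prop. 13.91 (3)] -/
theorem IsBlowup.isIrreducible_preimage_of_isPiecePartition_cons {Z : Closeds X} {Zs : List (Closeds X)}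
    (hP : IsPiecePartition C (Z :: Zs)) {X₁ : Scheme.{u}} {τ₁ : X₁ ⟶ X}
    (hτ₁ : IsBlowup τ₁ (vanishingIdeal Z)) {W : Closeds X} (hW : W ∈ Zs) (hirr : IsIrreducible (W : Set X)) :
    IsIrreducible (W.preimage τ₁.continuous : Set X₁) :=
  hτ₁.isIrreducible_preimage_of_disjoint' (hP.disjoint_of_mem_tail hW) hirr

end Pieces

/-! ## Consumer form: a regular centre written as a disjoint union `V(C) = Z₁ ⊔ Z₂` of two closed subsets

The binary split in the currency asked for by the W5.2 transport (res-D-pv-054, 2026-08-27): inputs a regular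
centre `C` (`Scheme.IsRegular C.subscheme`, hence `C = 𝓘(V(C))`: tree `eq_vanishingIdeal_support_of_isRegular`),
closed `Z₁, Z₂` with `Z₁ ∩ Z₂ = ∅` and `Z₁ ∪ Z₂ = V(C)`; outputs `C = 𝓘(Z₁)·𝓘(Z₂)`, `𝓘(Z₁) + 𝓘(Z₂) = 𝒪`, the
regularity and stalks of the two pieces, and for every blow-up `τ` along `C` the factorisation `τ = τ₂ ≫ τ₁`
through a blow-up `τ₁ : W → X` along `𝓘(Z₁)` and a blow-up `τ₂` along `τ₁^*𝓘(Z₂)`, with `V(τ₁^*𝓘(Z₂)) = τ₁⁻¹Z₂`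
reduced and regular and `τ₁` a local isomorphism off `Z₁`. The `n`-ary split is obtained by iterating on
`τ₁⁻¹Z₂`, again a disjoint union of the preimages of the remaining pieces. -/

section DisjointUnion

variable {C : X.IdealSheafData} {Z₁ Z₂ : Closeds X}

/-- `V(C) = Z₁ ⊔ Z₂` as closed subsets. [folklore] -/
private theorem support_eq_sup_of_union_eq (hU : (Z₁ : Set X) ∪ (Z₂ : Set X) = (C.support : Set X)) :
    C.support = Z₁ ⊔ Z₂ :=
  Closeds.ext (by rw [Closeds.coe_sup]; exact hU.symm)

/-- **`[Z₁, Z₂]` is a piece partition of `V(C)`** when `Z₁ ∩ Z₂ = ∅` and `Z₁ ∪ Z₂ = V(C)` (BGMW §4 Step 2: the centre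
split into disjoint pieces). [cite: BierstoneGrigorievMilmanWlodarczyk2011, §4 Step 2 (p. 12)] -/
theorem isPiecePartition_pair (hZ : Disjoint (Z₁ : Set X) (Z₂ : Set X))
    (hU : (Z₁ : Set X) ∪ (Z₂ : Set X) = (C.support : Set X)) : IsPiecePartition C [Z₁, Z₂] := by
  refine ⟨?_, ?_⟩
  · simp only [List.pairwise_cons, List.mem_cons, List.not_mem_nil, or_false, forall_eq, List.Pairwise.nil,
      and_true, IsEmpty.forall_iff, implies_true]
    exact hZ
  · rw [← hU]
    simp

/-- **`C = 𝓘(Z₁) · 𝓘(Z₂)`** for a regular centre `V(C) = Z₁ ⊔ Z₂` (`C` is radical, `C = 𝓘(Z₁ ∪ Z₂) = 𝓘(Z₁) ∩ 𝓘(Z₂)`,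
and comaximal ideals multiply to their intersection). [cite: BierstoneGrigorievMilmanWlodarczyk2011, §4 Step 2 (p. 12)] -/
theorem eq_vanishingIdeal_mul_vanishingIdeal_of_disjoint_union (hC : Scheme.IsRegular C.subscheme)
    (hZ : Disjoint (Z₁ : Set X) (Z₂ : Set X)) (hU : (Z₁ : Set X) ∪ (Z₂ : Set X) = (C.support : Set X)) :
    C = vanishingIdeal Z₁ * vanishingIdeal Z₂ :=
  calc C = vanishingIdeal C.support := eq_vanishingIdeal_support_of_isRegular C hC
    _ = vanishingIdeal (Z₁ ⊔ Z₂) := by rw [support_eq_sup_of_union_eq hU]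
    _ = vanishingIdeal Z₁ * vanishingIdeal Z₂ := vanishingIdeal_sup_eq_mul_of_disjoint hZ

/-- **`𝓘(Z₁) + 𝓘(Z₂) = 𝒪_X`** for disjoint closed `Z₁, Z₂` (disjoint supports).
[cite: BierstoneGrigorievMilmanWlodarczyk2011, §4 Step 2 (p. 12)] -/
theorem vanishingIdeal_sup_vanishingIdeal_eq_top_of_disjoint (hZ : Disjoint (Z₁ : Set X) (Z₂ : Set X)) :
    vanishingIdeal Z₁ ⊔ vanishingIdeal Z₂ = (⊤ : X.IdealSheafData) := by
  apply IdealSheafData.sup_eq_top_of_disjoint_support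
  rwa [coe_support_vanishingIdeal, coe_support_vanishingIdeal]

variable [IsLocallyNoetherian X]

/-- **The piece `V(𝓘(Z₁))` of a regular centre `V(C) = Z₁ ⊔ Z₂` is regular** (its quotient stalks are those of
`V(C)`; tree `isRegular_subscheme_vanishingIdeal_piece`). [cite: StacksProject, Tag 0357] -/
theorem isRegular_subscheme_vanishingIdeal_left_of_disjoint_union (hC : Scheme.IsRegular C.subscheme)
    (hZ : Disjoint (Z₁ : Set X) (Z₂ : Set X)) (hU : (Z₁ : Set X) ∪ (Z₂ : Set X) = (C.support : Set X)) :
    Scheme.IsRegular (vanishingIdeal Z₁).subscheme :=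
  isRegular_subscheme_vanishingIdeal_piece hC (isPiecePartition_pair hZ hU) (by simp)

/-- **The piece `V(𝓘(Z₂))` of a regular centre `V(C) = Z₁ ⊔ Z₂` is regular.** [cite: StacksProject, Tag 0357] -/
theorem isRegular_subscheme_vanishingIdeal_right_of_disjoint_union (hC : Scheme.IsRegular C.subscheme)
    (hZ : Disjoint (Z₁ : Set X) (Z₂ : Set X)) (hU : (Z₁ : Set X) ∪ (Z₂ : Set X) = (C.support : Set X)) :
    Scheme.IsRegular (vanishingIdeal Z₂).subscheme :=
  isRegular_subscheme_vanishingIdeal_piece hC (isPiecePartition_pair hZ hU) (by simp)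

/-- On `Z₁` the piece ideal `𝓘(Z₁)` has the stalks of `C` (near a point of `Z₁` the piece is all of `V(C)`; tree
`stalkIdeal_centrePiece_eq`). Off `Z₁` its stalk is the unit ideal (tree `stalkIdeal_vanishingIdeal_of_not_mem`).
[cite: BierstoneGrigorievMilmanWlodarczyk2011, §4 Step 2 (p. 12)] -/
theorem stalkIdeal_vanishingIdeal_left_of_disjoint_union (hC : Scheme.IsRegular C.subscheme)
    (hZ : Disjoint (Z₁ : Set X) (Z₂ : Set X)) (hU : (Z₁ : Set X) ∪ (Z₂ : Set X) = (C.support : Set X))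
    {x : X} (hx : x ∈ (Z₁ : Set X)) : stalkIdeal (vanishingIdeal Z₁) x = stalkIdeal C x :=
  stalkIdeal_centrePiece_eq hC (isPiecePartition_pair hZ hU) (by simp) hx

/-- On `Z₂` the piece ideal `𝓘(Z₂)` has the stalks of `C`. [cite: BierstoneGrigorievMilmanWlodarczyk2011, §4 Step 2 (p. 12)] -/
theorem stalkIdeal_vanishingIdeal_right_of_disjoint_union (hC : Scheme.IsRegular C.subscheme)
    (hZ : Disjoint (Z₁ : Set X) (Z₂ : Set X)) (hU : (Z₁ : Set X) ∪ (Z₂ : Set X) = (C.support : Set X))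
    {x : X} (hx : x ∈ (Z₂ : Set X)) : stalkIdeal (vanishingIdeal Z₂) x = stalkIdeal C x :=
  stalkIdeal_centrePiece_eq hC (isPiecePartition_pair hZ hU) (by simp) hx

omit [IsLocallyNoetherian X] in
/-- The support of the pulled-back piece ideal is the preimage of the piece. [folklore] -/
private theorem coe_support_comap_vanishingIdeal {W : Scheme.{u}} (f : W ⟶ X) (Z : Closeds X) :
    (((vanishingIdeal Z).comap f).support : Set W) = f ⁻¹' (Z : Set X) := by
  rw [Scheme.IdealSheafData.support_comap, Closeds.coe_preimage, coe_support_vanishingIdeal]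

omit [IsLocallyNoetherian X] in
/-- A blow-up along `𝓘(Z₁)` is a local isomorphism off `Z₁`: its stalk maps at points not over `Z₁` are
isomorphisms (tree `IsBlowup.isIso_stalkMap_of_not_mem_support`). [cite: StacksProject, Tag 02OS] -/
theorem IsBlowup.isIso_stalkMap_of_not_mem_of_vanishingIdeal {W : Scheme.{u}} {τ₁ : W ⟶ X}
    (hτ₁ : IsBlowup τ₁ (vanishingIdeal Z₁)) {w : W} (hw : τ₁ w ∉ (Z₁ : Set X)) : IsIso (τ₁.stalkMap w) :=
  hτ₁.isIso_stalkMap_of_not_mem_support (by rwa [← coe_support_vanishingIdeal Z₁] at hw)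

/-- **The pulled-back second piece `V(τ₁^*𝓘(Z₂))` is regular** for any blow-up `τ₁` along `𝓘(Z₁)` of a regular
centre `V(C) = Z₁ ⊔ Z₂` (`τ₁^*𝓘(Z₂) = 𝓘(τ₁⁻¹Z₂)` is the reduced ideal of the preimage, over which `τ₁` is a local
isomorphism). [cite: BierstoneGrigorievMilmanWlodarczyk2011, Thm. 8.0.5 with Def. 3.1.3] -/
theorem IsBlowup.isRegular_subscheme_comap_vanishingIdeal_of_disjoint_union (hC : Scheme.IsRegular C.subscheme)
    (hZ : Disjoint (Z₁ : Set X) (Z₂ : Set X)) (hU : (Z₁ : Set X) ∪ (Z₂ : Set X) = (C.support : Set X))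
    {W : Scheme.{u}} {τ₁ : W ⟶ X} (hτ₁ : IsBlowup τ₁ (vanishingIdeal Z₁)) :
    Scheme.IsRegular ((vanishingIdeal Z₂).comap τ₁).subscheme := by
  rw [hτ₁.comap_vanishingIdeal_of_disjoint Z₂ (disjoint_support_vanishingIdeal_of_disjoint hZ)]
  exact hτ₁.isRegular_subscheme_vanishingIdeal_preimage_of_disjoint hZ
    (isRegular_subscheme_vanishingIdeal_right_of_disjoint_union hC hZ hU)

omit [IsLocallyNoetherian X] in
/-- **Splitting a blow-up along a regular centre `V(C) = Z₁ ⊔ Z₂` through a GIVEN blow-up `τ₁` along `𝓘(Z₁)`**: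
`∃ τ₂, IsBlowup τ₂ (τ₁^*𝓘(Z₂)) ∧ τ₂ ≫ τ₁ = τ` (literal equality of morphisms). [cite: StacksProject, Tag 080A] -/
theorem IsBlowup.exists_fac_of_disjoint_union (hC : Scheme.IsRegular C.subscheme)
    (hZ : Disjoint (Z₁ : Set X) (Z₂ : Set X)) (hU : (Z₁ : Set X) ∪ (Z₂ : Set X) = (C.support : Set X))
    (hτ : IsBlowup τ C) {W : Scheme.{u}} {τ₁ : W ⟶ X} (hτ₁ : IsBlowup τ₁ (vanishingIdeal Z₁)) :
    ∃ τ₂ : X' ⟶ W, IsBlowup τ₂ ((vanishingIdeal Z₂).comap τ₁) ∧ τ₂ ≫ τ₁ = τ := by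
  rw [eq_vanishingIdeal_mul_vanishingIdeal_of_disjoint_union hC hZ hU] at hτ
  exact hτ.exists_fac_of_mul hτ₁

/-- **Splitting a blow-up along a regular centre `V(C) = Z₁ ⊔ Z₂`** (`X` locally Noetherian, `Z₁ ∩ Z₂ = ∅`,
`Z₁ ∪ Z₂ = V(C)`): every blow-up `τ : X′ → X` along `C` factors as `τ = τ₂ ≫ τ₁` (LITERAL equality) with
`τ₁ : W → X` a blow-up along `𝓘(Z₁)` and `τ₂ : X′ → W` a blow-up along `τ₁^*𝓘(Z₂)`; moreover `W` is locally
Noetherian, `V(𝓘(Z₁))` and `V(τ₁^*𝓘(Z₂))` are regular, `V(τ₁^*𝓘(Z₂)) = τ₁⁻¹Z₂` with `τ₁^*𝓘(Z₂) = 𝓘(τ₁⁻¹Z₂)` the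
reduced ideal, and `τ₁` is a local isomorphism off `Z₁` (stalk maps isomorphisms; `τ₁` restricted over `X ∖ Z₁` an
isomorphism). Iterate on `τ₁⁻¹Z₂` for more than two pieces. [cite: StacksProject, Tag 080A] -/
theorem IsBlowup.exists_comp_eq_of_disjoint_union (hC : Scheme.IsRegular C.subscheme)
    (hZ : Disjoint (Z₁ : Set X) (Z₂ : Set X)) (hU : (Z₁ : Set X) ∪ (Z₂ : Set X) = (C.support : Set X))
    (hτ : IsBlowup τ C) :
    ∃ (W : Scheme.{u}) (τ₁ : W ⟶ X) (τ₂ : X' ⟶ W),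
      IsBlowup τ₁ (vanishingIdeal Z₁) ∧ IsBlowup τ₂ ((vanishingIdeal Z₂).comap τ₁) ∧ τ₂ ≫ τ₁ = τ ∧
      IsLocallyNoetherian W ∧ Scheme.IsRegular (vanishingIdeal Z₁).subscheme ∧
      Scheme.IsRegular ((vanishingIdeal Z₂).comap τ₁).subscheme ∧
      (((vanishingIdeal Z₂).comap τ₁).support : Set W) = τ₁ ⁻¹' (Z₂ : Set X) ∧
      (vanishingIdeal Z₂).comap τ₁ = vanishingIdeal (Z₂.preimage τ₁.continuous) ∧
      (∀ w : W, τ₁ w ∉ (Z₁ : Set X) → IsIso (τ₁.stalkMap w)) ∧ IsIso (τ₁ ∣_ Z₁.compl) := by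
  obtain ⟨W, τ₁, hτ₁⟩ := exists_isBlowup X (vanishingIdeal Z₁)
  obtain ⟨τ₂, hτ₂, h⟩ := hτ.exists_fac_of_disjoint_union hC hZ hU hτ₁
  exact ⟨W, τ₁, τ₂, hτ₁, hτ₂, h, hτ₁.isLocallyNoetherian,
    isRegular_subscheme_vanishingIdeal_left_of_disjoint_union hC hZ hU,
    hτ₁.isRegular_subscheme_comap_vanishingIdeal_of_disjoint_union hC hZ hU,
    coe_support_comap_vanishingIdeal τ₁ Z₂,
    hτ₁.comap_vanishingIdeal_of_disjoint Z₂ (disjoint_support_vanishingIdeal_of_disjoint hZ),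
    fun _ hw => hτ₁.isIso_stalkMap_of_not_mem_of_vanishingIdeal hw,
    hτ₁.isIso_morphismRestrict_compl_of_vanishingIdeal⟩

end DisjointUnion

end Literature.AlgebraicGeometry.Resolution

end
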